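import Summits.ResolutionOfSingularities.ResolutionOfSingularities.Theorems.PurelyInseparableDim4ChartAtlasSNCFarRepairCentre
import Summits.ResolutionOfSingularities.ResolutionOfSingularities.Theorems.PurelyInseparableDim4ChartAtlasSNCGoodFarPairs
import Summits.ResolutionOfSingularities.ResolutionOfSingularities.Theorems.PurelyInseparableDim4ChartAtlasSNCFarRepairPairs
import HarnessLib

/-!
# Purely inseparable four-folds `z^p + F(x₁, …, x₄)`: THE FAR-RESONANCE REPAIR CENTRE ON `W` FOR A PAIR-LIST BOUNDARY (the shape of PA3c
# p714892, typ-3's entry point; cell `res-dim4-pi`, typ-2 g7; HANDOFF OPEN 4/6 at W-level)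

[OURS · counted 0] (D-0157 DOOR 2; DR-157-C.) The pair-list twin of p719757 (`…SNCFarRepairCentre`): setting of PA3c p714892 — `π : W → 𝔸⁵` ANY
blowing up along `V(z, x_S)`, chart `j ∈ S`, `b_j = 0`, re-centring `Θⱼ` of record, `S' ∌ j`, old boundary `E = [(xᵢ + c)·𝒪 : (i, c) ∈ L]`
(`L : List (Fin 4 × K)`: near `(i, 0)`, far `(i, d)` with `i ∈ S`, `d ≠ 0`, transversal `i ∉ S`, parallel members allowed),
`M′ = ((z^p + F)·𝒪, E, p).transform π 𝓘Λ_S`, `Zc = 𝓘(closure φⱼ V(z, x_{S'}))`, and a nodup list `hs` of NON-ZERO heights. PROVED here (no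
`sorry`, no new axiom):

* `forall_mem_transform_boundary_comap_chart_pairs` — the transformed pair-list boundary read on the re-centred `x_j`-chart is in the
  natural-frame PAIR alphabet (hyperplanes `H`; far quadrics `((yᵢ + bᵢ)·y_j − 0·yᵢ + d)`, `(i, d) ∈ FQ`; the block of p710957 packaged);
* **`farRepairCentre_package_pairs`** — with `C(hs) = Π_{h ∈ hs} ψ_{−h}^*𝓘(V(y_0, y_{S'}, y_j))` and `C_W = 𝓘(closure φⱼ(V(C(hs))))`:
  `φⱼ^*C_W = C(hs)`, `V(C_W) ⊆ φⱼ(𝔸⁵)`, `V(C_W) ⊆ V(Zc)`, `V(C_W) ⊆ supp M′`, `V(C_W)` REGULAR, `HasSNCWith M′.boundary C_W` (snc on the chart by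
  p719034 `hasSNCWith_prod_heights_pairs` at `c′ = 0`, extended by Literature `HasSNC.hasSNCWith_vanishingIdeal_closureImage`).

Nothing here is a statement about resolution of singularities in dimension ≥ 4 / characteristic `p` (NOT proved anywhere in this programme).
bears_on: LADDER-RESOLUTION:D157-DOOR2 (res-dim4-pi). Supports stmt-ResolutionOfSingularities-16155 (helper).
-/

-- every declaration of this summit lives under `Summit.ResolutionOfSingularities.ResolutionOfSingularities`
-- (summit = problem), which the duplicate-namespace linter flags; house convention (cf. the Target file).
set_option linter.dupNamespace false

noncomputable section

open MvPolynomial CategoryTheory AlgebraicGeometry Opposite TopologicalSpace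
open AlgebraicGeometry.Scheme.IdealSheafData (ofIdealTop vanishingIdeal)

namespace Summit.ResolutionOfSingularities.ResolutionOfSingularities.Theorems.PIDim4

open Literature.AlgebraicGeometry.Resolution
open Literature.AlgebraicGeometry.Resolution.Hauser2010
open Literature.AlgebraicGeometry.Resolution.AffinePointBlowup (P A γ coord Wtop ξ)
open Literature.Barriers.ResolutionOfSingularities

namespace ChartDictionary

variable {K : Type} [Field K] {p : ℕ} [hp : Fact p.Prime] [CharP K p]
  {S S' : Finset (Fin 4)} {j : Fin 4} {b : Fin 4 → K} {Θⱼ : A 4 K ≃ₐ[K] A 4 K} {h : MvPolynomial (Fin 4) K}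
  {F F₁ : MvPolynomial (Fin 4) K} {W : Scheme.{0}} {π : W ⟶ P 4 K}

/-! ## §1 The transformed pair-list boundary read on the `x_j`-chart -/

/-- **The transformed pair-list boundary, read on the re-centred `x_j`-chart, is in the natural-frame pair alphabet**: `⊤`, hyperplanes
`(m, a) ∈ H` (with `E₁ ↦ (j⁺, 0)`, far `(j, c) ↦ (j⁺, c)`, near `(i, 0)`, `i ∈ S ∖ j` `↦ (i⁺, bᵢ)`, transversal `(i, c)`, `i ∉ S` `↦ (i⁺, bᵢ + c)`),
and far quadrics `((yᵢ + bᵢ)·y_j − 0·yᵢ + d)`, `(i, d) ∈ FQ` (`(i, d) ∈ L`, `i ∈ S ∖ j`, `d ≠ 0`). -/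
theorem forall_mem_transform_boundary_comap_chart_pairs [DecidableEq (Fin 4)] (hj : j ∈ S) (hbj : b j = 0)
    (hsj : ∀ i : Fin 4, Θⱼ (X i.succ) = X i.succ + C (b i))
    (hπ : IsBlowup π (AffineCoordBlowup.𝓘Λ 4 K (insert 0 (Fin.succ '' (S : Set (Fin 4)))))) (L : List (Fin 4 × K))
    (H : Finset (Fin (4 + 1) × K)) (hH0 : (j.succ, (0 : K)) ∈ H) (hHj : ∀ c : K, (j, c) ∈ L → (j.succ, c) ∈ H)
    (hHn : ∀ i : Fin 4, (i, (0 : K)) ∈ L → i ∈ S → i ≠ j → (i.succ, b i) ∈ H)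
    (hHt : ∀ ic ∈ L, ic.1 ∉ S → (ic.1.succ, b ic.1 + ic.2) ∈ H)
    (FQ : Finset (Fin 4 × K)) (hFQ : ∀ ic ∈ L, ic.1 ∈ S → ic.1 ≠ j → ic.2 ≠ 0 → ic ∈ FQ) :
    haveI : IsIso (CommRingCat.ofHom (Θⱼ : A 4 K →+* A 4 K)) := (inferInstance : IsIso Θⱼ.toRingEquiv.toCommRingCatIso.hom)
    ∀ D ∈ (((L.map fun ic => ofIdealTop (Ideal.span {(γ 4 K).symm (X ic.1.succ + C ic.2)})).map
          (strictTransformIdeal π (AffineCoordBlowup.𝓘Λ 4 K (insert 0 (Fin.succ '' (S : Set (Fin 4)))))) ++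
        [(AffineCoordBlowup.𝓘Λ 4 K (insert 0 (Fin.succ '' (S : Set (Fin 4))))).comap π]).map
        (·.comap (Spec.map (CommRingCat.ofHom (Θⱼ : A 4 K →+* A 4 K)) ≫ AffineCoordBlowup.chartImm hπ (succ_mem_centreVars hj)))),
      D = ⊤ ∨ (∃ ma ∈ H, D = ofIdealTop (Ideal.span {(γ 4 K).symm (X ma.1 + C ma.2)})) ∨
        ∃ kε ∈ FQ, D = ofIdealTop (Ideal.span {(γ 4 K).symm
          ((X kε.1.succ + C (b kε.1)) * X j.succ - C (0 : K) * X kε.1.succ + C kε.2)}) := by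
  haveI : IsIso (CommRingCat.ofHom (Θⱼ : A 4 K →+* A 4 K)) := (inferInstance : IsIso Θⱼ.toRingEquiv.toCommRingCatIso.hom)
  intro D hD
  rw [List.map_append, List.map_map, List.map_map, List.mem_append, List.mem_map, List.map_singleton, List.mem_singleton] at hD
  rcases hD with ⟨ic, hic, rfl⟩ | rfl
  · simp only [Function.comp_apply]
    by_cases hij : ic.1 = j
    · by_cases hc : ic.2 = 0
      · left
        have e1 : ic = (j, 0) := Prod.ext hij hc
        rw [e1, C_0, add_zero, Scheme.IdealSheafData.comap_comp, show (γ 4 K).symm (X j.succ) = coord 4 K j.succ from rfl,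
          strictTransformIdeal_hyperplane_self_comap_chartImm hj hπ, Scheme.IdealSheafData.comap_top]
      · right; left
        refine ⟨(j.succ, ic.2), hHj ic.2 (by rw [← hij]; exact hic), ?_⟩
        have e1 : ic = (j, ic.2) := Prod.ext hij rfl
        rw [e1]
        change (strictTransformIdeal π _ (ofIdealTop (Ideal.span {(γ 4 K).symm (X j.succ + C ic.2)}))).comap _ = _
        rw [comap_recenter_chart_strictTransform_far_self hj hc hsj hπ, hbj, zero_add]
    · by_cases hiS : ic.1 ∈ S
      · by_cases hc : ic.2 = 0
        · right; left
          refine ⟨(ic.1.succ, b ic.1), hHn ic.1 (by rw [← hc]; exact hic) hiS hij, ?_⟩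
          rw [hc, C_0, add_zero, Scheme.IdealSheafData.comap_comp, show (γ 4 K).symm (X ic.1.succ) = coord 4 K ic.1.succ from rfl,
            strictTransformIdeal_hyperplane_comap_chartImm hj hij hπ, show coord 4 K ic.1.succ = (γ 4 K).symm (X ic.1.succ) from rfl,
            comap_ofIdealTop_span_γ_symm, RingHom.coe_coe, hsj ic.1]
        · right; right
          refine ⟨ic, hFQ ic hic hiS hij hc, ?_⟩
          rw [comap_recenter_chart_strictTransform_far hj hiS hij hc hsj hπ, hbj, C_0, add_zero, zero_mul, sub_zero]
      · right; left
        refine ⟨(ic.1.succ, b ic.1 + ic.2), hHt ic hic hiS, ?_⟩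
        have hC : Θⱼ (C ic.2) = C ic.2 := Θⱼ.commutes ic.2
        rw [Scheme.IdealSheafData.comap_comp, strictTransformIdeal_translate_comap_chartImm hj hiS ic.2 hπ, comap_ofIdealTop_span_γ_symm,
          RingHom.coe_coe, map_add, hsj ic.1, hC, add_assoc, ← C_add]
  · right; left
    refine ⟨(j.succ, 0), hH0, ?_⟩
    rw [Scheme.IdealSheafData.comap_comp, comap_𝓘Λ_chartImm hj hπ, show coord 4 K j.succ = (γ 4 K).symm (X j.succ) from rfl,
      comap_ofIdealTop_span_γ_symm, RingHom.coe_coe, hsj j, hbj]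

/-! ## §2 The repair centre on `W`, pair-list boundary -/

/-- **THE FAR-RESONANCE REPAIR CENTRE ON `W` FOR A PAIR-LIST BOUNDARY** (escaping case `j ∉ S'`; heights `hs ≠ []` pairwise distinct, non-zero;
`L` any pair list). `C_W = 𝓘(closure φⱼ(V(C(hs))))`: `φⱼ^*C_W = C(hs)`, `V(C_W) ⊆ φⱼ(𝔸⁵)`, `V(C_W) ⊆ V(Zc) ⊆ supp M′`, `V(C_W)` REGULAR, and
`HasSNCWith M′.boundary C_W`. -/
theorem farRepairCentre_package_pairs [IsAlgClosed K] (hj : j ∈ S) (hjS' : j ∉ S') (hbj : b j = 0)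
    (h0j : Θⱼ (X 0) = X 0 + rename Fin.succ h) (hsj : ∀ i : Fin 4, Θⱼ (X i.succ) = X i.succ + C (b i))
    (hπ : IsBlowup π (AffineCoordBlowup.𝓘Λ 4 K (insert 0 (Fin.succ '' (S : Set (Fin 4))))))
    (hperm : (p : ℕ∞) ≤ CentreBlowup.ordAlong S F)
    (hread : Θⱼ (coordBlowupSubst K (insert 0 (Fin.succ '' (S : Set (Fin 4)))) j.succ (hyp p F)) = X j.succ ^ p * hyp p F₁)
    (hperm' : (p : ℕ∞) ≤ CentreBlowup.ordAlong S' F₁) (L : List (Fin 4 × K))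
    (hs : List K) (hne : hs ≠ []) (hnd : hs.Nodup) (h0 : ∀ h' ∈ hs, h' ≠ 0) :
    haveI : IsIso (CommRingCat.ofHom (Θⱼ : A 4 K →+* A 4 K)) := (inferInstance : IsIso Θⱼ.toRingEquiv.toCommRingCatIso.hom)
    let φⱼ := Spec.map (CommRingCat.ofHom (Θⱼ : A 4 K →+* A 4 K)) ≫ AffineCoordBlowup.chartImm hπ (succ_mem_centreVars hj)
    let Zc := vanishingIdeal (closureImage φⱼ ((AffineCoordBlowup.𝓘Λ 4 K (insert 0 (Fin.succ '' (S' : Set (Fin 4))))).support : Set (P 4 K)))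
    let M' := ((⟨hypSheaf p F, L.map fun ic => ofIdealTop (Ideal.span {(γ 4 K).symm (X ic.1.succ + C ic.2)}), p⟩ :
        MarkedIdeal (P 4 K)).transform π (AffineCoordBlowup.𝓘Λ 4 K (insert 0 (Fin.succ '' (S : Set (Fin 4))))))
    let Cmod := (hs.map fun h' => (AffineCoordBlowup.𝓘Λ 4 K (insert 0 (Fin.succ '' ((insert j S' : Finset (Fin 4)) : Set (Fin 4))))).comap
      (Spec.map (CommRingCat.ofHom ((AffinePointBlowup.translateEquiv (n := 4) (Pi.single j.succ (-h')) : A 4 K ≃ₐ[K] A 4 K) :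
        A 4 K →+* A 4 K)))).prod
    let CW := vanishingIdeal (closureImage φⱼ (Cmod.support : Set (P 4 K)))
    CW.comap φⱼ = Cmod ∧ (CW.support : Set W) ⊆ Set.range φⱼ ∧ (CW.support : Set W) ⊆ Zc.support ∧
      (CW.support : Set W) ⊆ M'.support ∧ Scheme.IsRegular CW.subscheme ∧ HasSNCWith M'.boundary CW := by
  intro φⱼ Zc M' Cmod CW
  classical
  haveI hisoj : IsIso (CommRingCat.ofHom (Θⱼ : A 4 K →+* A 4 K)) := (inferInstance : IsIso Θⱼ.toRingEquiv.toCommRingCatIso.hom)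
  haveI : IsOpenImmersion φⱼ := inferInstanceAs (IsOpenImmersion
    (Spec.map (CommRingCat.ofHom (Θⱼ : A 4 K →+* A 4 K)) ≫ AffineCoordBlowup.chartImm hπ (succ_mem_centreVars hj)))
  haveI : IsProper π := hπ.isProper
  haveI : IsLocallyNoetherian W := LocallyOfFiniteType.isLocallyNoetherian π
  set Λ : Set (Fin (4 + 1)) := insert 0 (Fin.succ '' (S : Set (Fin 4))) with hΛ
  -- everything but the snc clause is the index-free part of p719757 (with the empty near/far lists)
  obtain ⟨hcomap, hrange, hZsub, -, hreg, -⟩ := farRepairCentre_package hj hjS' hbj h0j hsj hπ hperm hread hperm' [] [] (fun _ => 0)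
    (fun _ => 0) (fun _ _ => rfl) (fun i hi => by simp at hi) (fun i hi => by simp at hi) hs hne hnd h0
  have hZsupp : (Zc.support : Set W) ⊆ M'.support :=
    support_globalCentre_subset_support_transform_of_reading hj hbj h0j hsj hπ hperm hread hperm' _ rfl rfl
  refine ⟨hcomap, hrange, hZsub, fun w hw => hZsupp (hZsub hw), hreg, ?_⟩
  -- snc: the transformed boundary is snc on `W`, and its chart readings are snc with `C(hs)`
  have hCreg : Scheme.IsRegular Cmod.subscheme := isRegular_subscheme_prod_heights (K := K) (T := S') (j := j) hs hnd
  haveI : IsReduced Cmod.subscheme := hCreg.isReduced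
  have hCrad : Cmod.radical = Cmod := radical_eq_of_isReduced_subscheme Cmod
  set E : List (Scheme.IdealSheafData (P 4 K)) := L.map fun ic => ofIdealTop (Ideal.span {(γ 4 K).symm (X ic.1.succ + C ic.2)}) with hEdef
  have hE : HasSNCWith E (AffineCoordBlowup.𝓘Λ 4 K Λ) := by
    refine hasSNCWith_𝓘Λ_hyperplanes_pairs Λ (L.toFinset.image fun ic => (ic.1.succ, ic.2)) fun D hD => Or.inr ?_
    obtain ⟨ic, hic, rfl⟩ := List.mem_map.mp hD
    exact ⟨(ic.1.succ, ic.2), Finset.mem_image.mpr ⟨ic, List.mem_toFinset.mpr hic, rfl⟩, rfl⟩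
  have hsncW : HasSNC M'.boundary := by
    show HasSNC (((⟨hypSheaf p F, E, p⟩ : MarkedIdeal (P 4 K)).transform π (AffineCoordBlowup.𝓘Λ 4 K Λ)).boundary)
    rw [MarkedIdeal.transform_boundary]
    exact hE.hasSNC_transform hπ
  -- the closed set `T` of p719757 (same argument): `V(C_W) ⊆ T ⊆ φⱼ(𝔸⁵)`, `φⱼ(V(Cmod)) ⊆ T`
  have hT : ∃ T : Set W, IsClosed T ∧ T ⊆ Set.range φⱼ ∧ (Cmod.support : Set (P 4 K)) ⊆ φⱼ ⁻¹' T := by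
    refine ⟨(CW.support : Set W), CW.support.isClosed, hrange, fun y hy => ?_⟩
    show φⱼ y ∈ CW.support
    have h1 : y ∈ (CW.comap φⱼ).support := by rw [hcomap]; exact hy
    exact (mem_support_comap_iff _ _ y).mp h1
  obtain ⟨T, hTclosed, hTj, hCT⟩ := hT
  refine HasSNC.hasSNCWith_vanishingIdeal_closureImage φⱼ hsncW hCrad ?_ hTclosed hTj hCT
  -- the readings on the `x_j`-chart
  let H : Finset (Fin (4 + 1) × K) := insert (j.succ, (0 : K))
    (((L.toFinset.filter fun ic => ic.1 = j).image fun ic => (j.succ, ic.2)) ∪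
      ((L.toFinset.filter fun ic => ic.1 ∈ S ∧ ic.1 ≠ j ∧ ic.2 = 0).image fun ic => (ic.1.succ, b ic.1)) ∪
      ((L.toFinset.filter fun ic => ic.1 ∉ S).image fun ic => (ic.1.succ, b ic.1 + ic.2)))
  let FQ : Finset (Fin 4 × K) := L.toFinset.filter fun ic => ic.1 ∈ S ∧ ic.1 ≠ j ∧ ic.2 ≠ 0
  have hHmem : ∀ ka, ka ∈ H → ka = (j.succ, (0 : K)) ∨ (∃ c, (j, c) ∈ L ∧ ka = (j.succ, c)) ∨
      (∃ i, (i, (0 : K)) ∈ L ∧ i ∈ S ∧ i ≠ j ∧ ka = (i.succ, b i)) ∨ ∃ ic ∈ L, ic.1 ∉ S ∧ ka = (ic.1.succ, b ic.1 + ic.2) := by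
    intro ka hka
    simp only [H, Finset.mem_insert, Finset.mem_union, Finset.mem_image, Finset.mem_filter, List.mem_toFinset] at hka
    rcases hka with h | ((⟨ic, ⟨hic, hj'⟩, rfl⟩ | ⟨ic, ⟨hic, hiS, hij, hc0⟩, rfl⟩) | ⟨ic, ⟨hic, hiS⟩, rfl⟩)
    · exact Or.inl h
    · exact Or.inr (Or.inl ⟨ic.2, by rw [← hj']; exact hic, rfl⟩)
    · exact Or.inr (Or.inr (Or.inl ⟨ic.1, by rw [← hc0]; exact hic, hiS, hij, rfl⟩))
    · exact Or.inr (Or.inr (Or.inr ⟨ic, hic, hiS, rfl⟩))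
  have hFQ : ∀ id, id ∈ FQ ↔ id ∈ L ∧ id.1 ∈ S ∧ id.1 ≠ j ∧ id.2 ≠ 0 := fun id => by
    simp only [FQ, Finset.mem_filter, List.mem_toFinset]
  have hEshape := forall_mem_transform_boundary_comap_chart_pairs hj hbj hsj hπ L H (Finset.mem_insert_self _ _)
    (fun c hc => Finset.mem_insert_of_mem (Finset.mem_union_left _ (Finset.mem_union_left _
      (Finset.mem_image.mpr ⟨(j, c), Finset.mem_filter.mpr ⟨List.mem_toFinset.mpr hc, rfl⟩, rfl⟩))))
    (fun i hi hiS hij => Finset.mem_insert_of_mem (Finset.mem_union_left _ (Finset.mem_union_right _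
      (Finset.mem_image.mpr ⟨(i, 0), Finset.mem_filter.mpr ⟨List.mem_toFinset.mpr hi, hiS, hij, rfl⟩, rfl⟩))))
    (fun ic hic hiS => Finset.mem_insert_of_mem (Finset.mem_union_right _
      (Finset.mem_image.mpr ⟨ic, Finset.mem_filter.mpr ⟨List.mem_toFinset.mpr hic, hiS⟩, rfl⟩)))
    FQ (fun ic hic hiS hij hc => (hFQ ic).mpr ⟨hic, hiS, hij, hc⟩)
  show HasSNCWith (M'.boundary.map (·.comap φⱼ)) Cmod
  rw [show M'.boundary = E.map (strictTransformIdeal π (AffineCoordBlowup.𝓘Λ 4 K Λ)) ++ [(AffineCoordBlowup.𝓘Λ 4 K Λ).comap π] from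
    MarkedIdeal.transform_boundary _ _ _]
  refine hasSNCWith_prod_heights_pairs (K := K) (T := S') (j := j) (b := b) (c' := 0) hjS' hs hne hnd
    (fun h' hh' => by rw [zero_sub, neg_ne_zero]; exact h0 h' hh') H FQ (fun id hid => ((hFQ id).mp hid).2.2.1)
    (fun id hid => by rw [mul_zero, add_zero]; exact ((hFQ id).mp hid).2.2.2) ?_ hEshape
  -- (C1) a hyperplane of a quadric's index is the near member of that index
  intro id hid a ha
  obtain ⟨-, hiS, hij, -⟩ := (hFQ id).mp hid
  rcases hHmem _ ha with e | ⟨c, -, e⟩ | ⟨i, -, -, -, e⟩ | ⟨ic, -, hicS, e⟩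
  · exact absurd (Fin.succ_injective _ (Prod.mk.inj e).1) hij
  · exact absurd (Fin.succ_injective _ (Prod.mk.inj e).1) hij
  · obtain ⟨e1, e2⟩ := Prod.mk.inj e
    rw [e2, Fin.succ_injective _ e1]
  · exact absurd ((Fin.succ_injective _ (Prod.mk.inj e).1) ▸ hiS) hicS

end ChartDictionary

end Summit.ResolutionOfSingularities.ResolutionOfSingularities.Theorems.PIDim4

end
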